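/-
Copyright (c) 2026 the pub-hodgecm-mathlib formalisation cell (harness21).  Prover seat hodgecm-mathlib-F0P3-p01 (g31), «(D-RAM) FOUR-FRAME» road of crux H413, line LH4,
unit U3_Laws, κ-STAGE B brick κG₂ «G₁-κ» (dealer LH4-plan (g11) WORD #52 (a); letter LH4-p09 (g3) `LETTER-kappaBG-tv2.v1` §1, κ owner LH4-p05 (g3)).
FILE κG₂-A2 (part 2) — THE κ-COUNT OF THE TYPE-2 GLUED CLASS REPRESENTATIVE AS A SUM OVER THE (R)-PARAMETER CLASSES.  2026-09-04.
-/
import Summits.HodgeConjecture.HodgeConjecture.Theorems.F0P3cDyRamDiagonalKappaGluedClassTwo    -- κG₂-A2 part 1 (this seat): S_F, windows, section signs, killers; brings ★ G2-B, ★ κG-A2, ★ TraceBound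
import HarnessLib

/-!
# Crux `H413`, κ-STAGE B brick κG₂, FILE A2 (part 2): `kappaCount σ ϖ 2 i (latt V(1,1,g)) = Σ_{f ∈ S} [window_i]·χ_i(D(f))`

Cell `hodgecm-mathlib` (D-0151), FLOOR 0, crux item H413 = `stmt-HodgeConjecture-24833`; lane `--supports stmt-HodgeConjecture-24833 --as helper` (count-neutral).  THEOREMS ONLY
(no `def`, no instance, no notation, no `sorry`).  Representative `V = (1 0 0; 1 ϖ^ρ 0; 1+g ϖ^ρ ϖ^{2ρ+2t+1})`, `g` fixed, `|g| = |ϖ|^{2t}`, `ρ, t ≥ 1`.  The polarisation cosets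
of `latt V` at vertex type 2 are parametrised by the σ-fixed (R)-parameters `f ≡ g (𝔭^{ρ+2t})` modulo `𝔭^{ρ+2t+1}` through LH4-p08 (g3)'s explicit section `D(f)`
(★ G2-B `explicitForm_polarises_and_fParam`; structure ★ G2-A1; class criterion ★ G2-A2 `exists_stabiliser_iff_v_fParam_sub_le`): for a complete irredundant finite system `S`
of such parameters, `polarisationCosets = (f ↦ D(f)·S_F)''S` injectively, so `kappaCount σ ϖ 2 i (latt V) = Σ_{f ∈ S} cosetKappa σ i (D(f)·S_F)`, and each coset is
`[window_i]·χ_i(D(f))` by ★ Fκ2 `cosetKappa_coset_eq_of_dichotomy` + part 1 (`forall_chiVec_eq_one_iff_window_two`, `chiVec_section_two`).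
HEAD **`kappaCount_two_latt_glued_rep`**.  Summing it over the class representatives `g` (★ κG₂-C1 p856753) and swapping the sums gives the κ-census of the type-2 glued
stratum as ★ κG-B2's character sums at level `ρ+1+2t` — the socket κG₂-C2 (LH4-p09 (g3)'s LETTER κB-G₂ v1 §2–§3; REF5 R5-108 numerics).
HONEST LABEL.  Count-neutral (`--supports`); the κ-laws stay PROVER TARGETS; `HC_CM` is proved only modulo the 7 printed citations (2 remaining named inputs: hLiu418 =
`stmt-HodgeConjecture-24832`, h413 = `stmt-HodgeConjecture-24833`) until rung 0 closes.

## References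
* [Kottwitz1986BaseChangeUnits] R. E. Kottwitz, *Base change for unit elements of Hecke algebras*, Compositio Math. 60 (1986), §1 pp. 240–241 (fixed-lattice counts via torus orbits).
* [LanglandsShelstad1987] R. P. Langlands, D. Shelstad, *On the definition of transfer factors*, Math. Ann. 278 (1987), §3 (the κ-signs).
* [Serre1979] J.-P. Serre, *Local Fields*, GTM 67 (1979), Ch. V §3 Prop. 5, Cor. 3; Ch. XV §2.
-/

set_option autoImplicit false

noncomputable section

namespace Summit.HodgeConjecture.HodgeConjecture.Cruxes.H413.F0P3cDyRamDiagonalKappaGluedClassTwoCount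

open Matrix
open Literature.NumberTheory.Automorphic Literature.NumberTheory.Automorphic.HermitianLattice Literature.NumberTheory.Automorphic.UnitaryGroup
open Literature.NumberTheory.Automorphic.UnitaryLatticeTree Literature.NumberTheory.Automorphic.UnitaryThreeFourFrame
open Literature.NumberTheory.LocalFields.WildQuadraticDatum
open Summit.HodgeConjecture.HodgeConjecture.Cruxes.H413.F0P3cDyRamDiagonalTorusDefs
open Summit.HodgeConjecture.HodgeConjecture.Cruxes.H413.F0P3cDyRamDiagonalStrataDefs
open Summit.HodgeConjecture.HodgeConjecture.Cruxes.H413.F0P3cDyRamDiagonalKappaCountDefs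
open Summit.HodgeConjecture.HodgeConjecture.Cruxes.H413.F0P3cDyRamDiagonalKappaCountEval hiding normSign_mul_of_dichotomy
open Summit.HodgeConjecture.HodgeConjecture.Cruxes.H413.F0P3cDyRamDiagonalKappaGluedClassTwo
open Summit.HodgeConjecture.HodgeConjecture.Cruxes.H413.F0P3cDyRamDiagonalGluedPolarisationStructureTypeTwo (structure_of_polarisation)
open Summit.HodgeConjecture.HodgeConjecture.Cruxes.H413.F0P3cDyRamDiagonalGluedPolarisationClassesTypeTwo (exists_stabiliser_iff_v_fParam_sub_le)
open Summit.HodgeConjecture.HodgeConjecture.Cruxes.H413.F0P3cDyRamDiagonalGluedPolarisationCountTypeTwo (explicitForm_polarises_and_fParam mem_coset_self coset_eq_of_exists)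
open scoped Valued WithZero Matrix MatrixGroups

variable {K : Type} [Field K] [Valued K ℤᵐ⁰] [CompleteSpace K] [Finite 𝓀[K]] {σ : K →+* K} {ϖ : K} {d t₂ : ℕ}

open Classical in
/-- **THE κ-COUNT OF THE TYPE-2 GLUED CLASS REPRESENTATIVE `latt V(1,1,g)`, COSET BY COSET** (ramified quadratic datum with `|2| < 1` on a complete `K` with finite residue field;
`ρ, t ≥ 1`, `g` fixed with `|g| = |ϖ|^{2t}`; `S` a finite complete irredundant system, modulo `𝔭^{ρ+2t+1}`, of the σ-fixed (R)-parameters `f` with `|g − f| ≤ |ϖ|^{ρ+2t}`;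
`ω = normSign σ`): `kappaCount σ ϖ 2 i (latt V) = Σ_{f ∈ S} (![ [2d ≤ ρ+2t+2]·ω(−1)ω(1+f), [2d ≤ ρ+2]·ω(−1)ω(f)ω(1+f), [2d ≤ ρ+2]·ω(f) ] i)`.
[cite: Kottwitz1986BaseChangeUnits, §1 pp. 240–241] [cite: LanglandsShelstad1987, §3] [cite: Serre1979, Ch. V §3 Prop. 5, Cor. 3] -/
theorem kappaCount_two_latt_glued_rep (hD : IsRamifiedQuadraticDatum σ ϖ d t₂) (h2 : Valued.v (2 : K) < 1) {ρ t : ℕ} (hρ : 1 ≤ ρ) (ht : 1 ≤ t)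
    {g : K} (hσg : σ g = g) (hg : Valued.v g = Valued.v ϖ ^ (2 * t)) (V : GL (Fin 3) K)
    (hV : (V : Matrix (Fin 3) (Fin 3) K) = !![1, 0, 0; 1, ϖ ^ ρ, 0; 1 * 1 + g, ϖ ^ ρ * 1, ϖ ^ (2 * ρ + 2 * t + 1)])
    (S : Finset K) (hS1 : ∀ f ∈ S, σ f = f ∧ Valued.v (g - f) ≤ Valued.v ϖ ^ (ρ + 2 * t))
    (hS2 : ∀ f' : K, σ f' = f' → Valued.v (g - f') ≤ Valued.v ϖ ^ (ρ + 2 * t) → ∃ f ∈ S, Valued.v (f' - f) ≤ Valued.v ϖ ^ (ρ + 2 * t + 1))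
    (hS3 : ∀ f ∈ S, ∀ f' ∈ S, Valued.v (f - f') ≤ Valued.v ϖ ^ (ρ + 2 * t + 1) → f = f') (i : Fin 3) :
    kappaCount σ ϖ 2 i (latt (V : Matrix (Fin 3) (Fin 3) K)) =
      ∑ f ∈ S, (![if 2 * d ≤ ρ + 2 * t + 2 then normSign σ (-1) * normSign σ (1 + f) else 0,
         if 2 * d ≤ ρ + 2 then normSign σ (-1) * normSign σ f * normSign σ (1 + f) else 0,
         if 2 * d ≤ ρ + 2 then normSign σ f else 0] : Fin 3 → ℤ) i := by
  obtain ⟨hσ, hvσ, hϖ, hfix, hdd, hd1, -⟩ := id hD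
  have hTr := trace_bound_of_isRamifiedQuadraticDatum hD h2
  have hϖ0 : ϖ ≠ 0 := (Valuation.ne_zero_iff _).1 (by rw [hϖ]; exact WithZero.exp_ne_zero)
  have hϖ1 : Valued.v ϖ < 1 := by rw [hϖ, ← WithZero.exp_zero, WithZero.exp_lt_exp]; norm_num
  have hvϖ : 0 < Valued.v ϖ := (Valuation.pos_iff _).2 hϖ0
  obtain ⟨c, hσc, hcn, hdich⟩ := exists_nonnorm_dichotomy hD
  have hg0 : g ≠ 0 := fun h => by rw [h, map_zero] at hg; exact (pow_ne_zero _ hvϖ.ne') hg.symm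
  have hgv : Valued.v g < 1 := by rw [hg]; exact pow_lt_one₀ zero_le hϖ1 (by omega)
  set M := latt (V : Matrix (Fin 3) (Fin 3) K) with hM
  -- the type-2 letters of LH4-p08 (g3)'s files: corner `2ρ + 1 + 2t`, (R) in the form `|ζσy″ − σx·f|`
  have hV' : (V : Matrix (Fin 3) (Fin 3) K) = !![1, 0, 0; 1, ϖ ^ ρ, 0; 1 * 1 + g, ϖ ^ ρ * 1, ϖ ^ (2 * ρ + 1 + 2 * t)] := by
    rw [hV, show 2 * ρ + 2 * t + 1 = 2 * ρ + 1 + 2 * t by ring]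
  have h11 : Valued.v (1 : K) = 1 := map_one _
  have hRiff : ∀ f : K, Valued.v ((1 : K) * σ g - σ 1 * f) = Valued.v (g - f) := fun f => by rw [one_mul, map_one, one_mul, hσg]
  -- the (R)-parameters in `S` are non-zero of valuation `|ϖ|^{2t}` with `1 + f ≠ 0`
  have hlt : Valued.v ϖ ^ (ρ + 2 * t) < Valued.v ϖ ^ (2 * t) := by
    rw [pow_add, mul_comm]; exact mul_lt_of_lt_one_right (pow_pos hvϖ _) (pow_lt_one₀ zero_le hϖ1 (by omega))
  have hfv : ∀ f : K, Valued.v (g - f) ≤ Valued.v ϖ ^ (ρ + 2 * t) → Valued.v f = Valued.v ϖ ^ (2 * t) := fun f hf => by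
    have h := Valuation.map_sub_eq_of_lt_left Valued.v (hg ▸ hf.trans_lt hlt : Valued.v (g - f) < Valued.v g)
    rw [← hg, ← h, sub_sub_cancel]
  have hf0 : ∀ f : K, Valued.v (g - f) ≤ Valued.v ϖ ^ (ρ + 2 * t) → f ≠ 0 := fun f hf h => by
    have := hfv f hf; rw [h, map_zero] at this; exact (pow_ne_zero _ hvϖ.ne') this.symm
  have h1f : ∀ f : K, Valued.v (g - f) ≤ Valued.v ϖ ^ (ρ + 2 * t) → 1 + f ≠ 0 := fun f hf h => by
    have hv1 : Valued.v (1 + f) = 1 := Valued.v.map_one_add_of_lt (by rw [hfv f hf]; exact pow_lt_one₀ zero_le hϖ1 (by omega))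
    rw [h, map_zero] at hv1; exact zero_ne_one hv1
  -- the explicit section and its class
  set P : K := ((ϖ * σ ϖ) ^ (ρ + 2 * t / 2))⁻¹ with hP
  set Dsec : K → Fin 3 → K := fun f =>
    ![-(P * (((1 : K) * σ g - σ 1 * f) * (σ 1 * g - 1 * f)) / f) - (σ 1 * (-(P * ((1 : K) * σ 1 + f))) * 1 + σ ((1 : K) * 1 + g) * P * ((1 : K) * 1 + g)),
      -(P * ((1 : K) * σ 1 + f)), P] with hDsec
  have hsec : ∀ f : K, σ f = f → Valued.v (g - f) ≤ Valued.v ϖ ^ (ρ + 2 * t) →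
      ((∀ j, σ (Dsec f j) = Dsec f j ∧ Dsec f j ≠ 0) ∧ IsVertexLattice σ ϖ (Matrix.diagonal (Dsec f)) 2 M) ∧ -(Dsec f 1 + Dsec f 2 * ((1 : K) * σ 1)) / Dsec f 2 = f :=
    fun f hf hR => explicitForm_polarises_and_fParam hσ hvσ hϖ0 hϖ1 hTr ρ (2 * t) hρ (dvd_mul_right 2 t) (by omega) h11 h11 hg V hV' hf ((hRiff f).symm ▸ hR)
  set coset : (Fin 3 → K) → Set (Fin 3 → K) := fun D => {D' : Fin 3 → K | ∃ u ∈ fixedUnitStabilizer σ M, ∀ j, D' j = D j * ((u j : Kˣ) : K)} with hcoset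
  -- relatedness of two sections ⟺ closeness of the parameters (★ G2-A2)
  have key : ∀ f f' : K, σ f = f → Valued.v (g - f) ≤ Valued.v ϖ ^ (ρ + 2 * t) → σ f' = f' → Valued.v (g - f') ≤ Valued.v ϖ ^ (ρ + 2 * t) →
      ((∃ u ∈ fixedUnitStabilizer σ M, ∀ j, Dsec f' j = Dsec f j * ((u j : Kˣ) : K)) ↔ Valued.v (f - f') ≤ Valued.v ϖ ^ (ρ + 2 * t + 1)) := by
    intro f f' hf hR hf' hR'
    obtain ⟨⟨hDa, hva⟩, hpa⟩ := hsec f hf hR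
    obtain ⟨⟨hDb, hvb⟩, hpb⟩ := hsec f' hf' hR'
    exact exists_stabiliser_iff_v_fParam_sub_le hσ hvσ hfix hϖ hρ (2 * t) (dvd_mul_right 2 t) (by omega) h11 h11 hg V hV' hDa hva hDb hvb hpa.symm hpb.symm
  -- `polarisationCosets` is the image of `S`
  have himage : polarisationCosets σ ϖ 2 M = ↑(S.image fun f => coset (Dsec f)) := by
    ext C
    rw [Finset.coe_image, Set.mem_image, mem_polarisationCosets_iff]
    constructor
    · rintro ⟨D, ⟨hDfix, hvert⟩, rfl⟩
      obtain ⟨⟨hfD, hRD, -⟩, -, -, -⟩ := structure_of_polarisation hσ hvσ hfix hϖ hρ (2 * t) (dvd_mul_right 2 t) (by omega) h11 h11 hg V hV' hDfix hvert rfl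
      set fD : K := -(D 1 + D 2 * ((1 : K) * σ 1)) / D 2 with hfDdef
      have hRD' : Valued.v (g - fD) ≤ Valued.v ϖ ^ (ρ + 2 * t) := (hRiff fD) ▸ hRD
      obtain ⟨f, hfS, hff⟩ := hS2 fD hfD hRD'
      refine ⟨f, Finset.mem_coe.2 hfS, ?_⟩
      -- `D ~ D(f)`: both (R)-parameters are `𝔭^{ρ+2t+1}`-close
      obtain ⟨⟨hDf, hvf⟩, hpf⟩ := hsec f (hS1 f hfS).1 (hS1 f hfS).2
      have hrel : ∃ u ∈ fixedUnitStabilizer σ M, ∀ j, D j = Dsec f j * ((u j : Kˣ) : K) := by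
        refine (exists_stabiliser_iff_v_fParam_sub_le hσ hvσ hfix hϖ hρ (2 * t) (dvd_mul_right 2 t) (by omega) h11 h11 hg V hV' hDf hvf hDfix hvert
          hpf.symm rfl).2 ?_
        rw [Valuation.map_sub_swap]; exact hff
      exact (coset_eq_of_exists σ M hrel).symm
    · rintro ⟨f, hfS, rfl⟩
      have hfS' := Finset.mem_coe.1 hfS
      exact ⟨Dsec f, (hsec f (hS1 f hfS').1 (hS1 f hfS').2).1, rfl⟩
  have hinj : Set.InjOn (fun f => coset (Dsec f)) ↑S := by
    intro f hf f' hf' h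
    have hfS := Finset.mem_coe.1 hf
    have hf'S := Finset.mem_coe.1 hf'
    refine hS3 f hfS f' hf'S ((key f f' (hS1 f hfS).1 (hS1 f hfS).2 (hS1 f' hf'S).1 (hS1 f' hf'S).2).1 ?_)
    have hmem : Dsec f' ∈ coset (Dsec f) := by simp only [h]; exact mem_coset_self σ M _
    exact hmem
  -- the κ-count as a sum over `S`
  rw [kappaCount, himage, finsum_mem_coe_finset, Finset.sum_image hinj]
  refine Finset.sum_congr rfl fun f hfS => ?_
  obtain ⟨hσf, hRf⟩ := hS1 f hfS
  obtain ⟨⟨hDf, -⟩, -⟩ := hsec f hσf hRf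
  rw [hcoset, cosetKappa_coset_eq_of_dichotomy σ hσc hcn hdich i M hDf]
  have hχ : chiVec σ i (Dsec f) = (![normSign σ (-1) * normSign σ (1 + f), normSign σ (-1) * normSign σ f * normSign σ (1 + f), normSign σ f] : Fin 3 → ℤ) i := by
    have h := chiVec_section_two hD ρ t hσg hg0 hσf (hf0 f hRf) (h1f f hRf) i
    rw [hDsec, hP, show ρ + 2 * t / 2 = ρ + t by omega]
    exact h
  have hwin := forall_chiVec_eq_one_iff_window_two hD h2 hρ ht hσg hg V hV i
  fin_cases i
  · simp only [Fin.zero_eta, Fin.isValue, Matrix.cons_val_zero] at hχ hwin ⊢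
    by_cases hw : 2 * d ≤ ρ + 2 * t + 2
    · rw [if_pos (hwin.2 hw), if_pos hw, hχ]
    · rw [if_neg (fun h => hw (hwin.1 h)), if_neg hw]
  · simp only [Fin.mk_one, Fin.isValue, Matrix.cons_val_one, Matrix.cons_val_zero] at hχ hwin ⊢
    by_cases hw : 2 * d ≤ ρ + 2
    · rw [if_pos (hwin.2 hw), if_pos hw, hχ]
    · rw [if_neg (fun h => hw (hwin.1 h)), if_neg hw]
  · simp only [Fin.reduceFinMk, Fin.isValue, Matrix.cons_val_two, Matrix.tail_cons, Matrix.head_cons] at hχ hwin ⊢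
    by_cases hw : 2 * d ≤ ρ + 2
    · rw [if_pos (hwin.2 hw), if_pos hw, hχ]
    · rw [if_neg (fun h => hw (hwin.1 h)), if_neg hw]

end Summit.HodgeConjecture.HodgeConjecture.Cruxes.H413.F0P3cDyRamDiagonalKappaGluedClassTwoCount

end
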